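import Summits.AnomalousDissipation.AnomalousDissipation.Theorems.SolenoidalFractalHomogenisationLagrangianStepCellChainDuhamel
import HarnessLib

/-!
# K1L_D `LagrangianRenormalisationStepDesign` (stmt-AnomalousDissipation-27980), `stub_cellLawV0_IS` V0:
# comparison of two frozen flows `exp(−tG₁) v − exp(−tG₂) v` under coercivity (generic; helper, `--supports stmt-AnomalousDissipation-27980`)

Summits-side helper file of route `SolenoidalFractalHomogenisation` (prover seat `ad-k1l-cellLawV-w1` g5; brick T7 of the V0 architecture note
`Cruxes/LagrangianRenormalisationStep/Lines/onelevel-V0-exact-family.md`).  Everything proved; no definitions, no named facts, no sorry.  Generic over a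
real inner-product space `E` (complete), `G₁ G₂ : E →L[ℝ] E`.

* `hasDerivAt_exp_neg_smul_apply'` — `d/ds exp(−sG) v = −G (exp(−sG) v)`.
* `exp_sub_exp_apply_eq_integral` — `exp(−tG₁)v − exp(−tG₂)v = −∫₀ᵗ exp(−(t−s)G₁) ((G₁ − G₂)(exp(−sG₂) v)) ds` (Duhamel, `…CellChainDuhamel`).
* **`norm_exp_sub_exp_apply_le`** — if `r₁‖w‖² ≤ ⟪G₁w,w⟫`, `r₂‖w‖² ≤ ⟪G₂w,w⟫` (`r₁, r₂ ≥ 0`) then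
  `‖exp(−tG₁)v − exp(−tG₂)v‖ ≤ ‖G₁ − G₂‖·t·‖v‖`, and for `r₁ > 0` also `≤ (‖G₁ − G₂‖/r₁)·‖v‖`; packaged: `≤ ‖G₁ − G₂‖·min t (1/r₁)·‖v‖`.
* `norm_exp_sub_exp_apply_le_rel` — the DECAY-RELATIVE form the (V) clause consumes: with `‖G₁ − G₂‖ ≤ ε·Γ` and `0 < r₁ ≤ Γ`,
  `‖exp(−tG₁)v − exp(−tG₂)v‖ ≤ ε·(Γ/r₁)·min 1 (Γ·t)·‖v‖` (a rate error `ε` relative to the scale `Γ` costs the window condition number `Γ/r₁`, uniformly in `t`).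
Consumer: step T7/T8 of V0 — the averaged slow generator `Ḡ` (period mean of the exact fast feedback) against the effective symbol
`effGen((1/n²)(𝔸 + (c/ν)Ψν(𝔸/ν)), ℓ)`, `ε = O(ϖ)`, `Γ = r̄`, `r₁` = the `NearIso` lower constant of the effective tensor.  NOT a proof of any registered stub,
of the crux, or of anomalous dissipation; rung F-D1.A0 infrastructure.
-/

set_option linter.dupNamespace false

noncomputable section

namespace Summit.AnomalousDissipation.AnomalousDissipation.Theorems.SolenoidalFractalHomogenisation.LagrangianStep.CellChain

open Set MeasureTheory Filter Topology NormedSpace intervalIntegral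
open scoped InnerProductSpace

section TwoSemigroup

variable {E : Type*} [NormedAddCommGroup E] [InnerProductSpace ℝ E] [CompleteSpace E]

/-- `d/ds [exp(−sG) v] = −G (exp(−sG) v)`. [folklore] -/
theorem hasDerivAt_exp_neg_smul_apply' (G : E →L[ℝ] E) (v : E) (s : ℝ) :
    HasDerivAt (fun u : ℝ => exp (-(u • G)) v) (-(G (exp (-(s • G)) v))) s := by
  have h1 : HasDerivAt (fun u : ℝ => exp (u • (-G))) (exp (s • (-G)) * (-G)) s := hasDerivAt_exp_smul_const (-G) s
  have h2 := h1.clm_apply (hasDerivAt_const s v)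
  simp only [smul_neg, mul_neg, neg_apply, map_zero, add_zero] at h2
  have hc : exp (-(s • G)) * G = G * exp (-(s • G)) := (((Commute.refl G).smul_left s).neg_left).exp_left.eq
  rw [mul_apply_eq_comp] at h2
  have h3 : (exp (-(s • G))) (G v) = G (exp (-(s • G)) v) := by
    have := congrArg (fun T : E →L[ℝ] E => T v) hc
    simpa only [mul_apply_eq_comp] using this
  rw [h3] at h2
  exact h2

/-- **Duhamel for the difference of two frozen flows**:
`exp(−tG₁)v − exp(−tG₂)v = −∫₀ᵗ exp(−(t−s)G₁)((G₁ − G₂)(exp(−sG₂)v)) ds` (`t ≥ 0`). [cite: Hale1980, Ch. III §1, Theorem 1.1] -/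
theorem exp_sub_exp_apply_eq_integral (G₁ G₂ : E →L[ℝ] E) (v : E) {t : ℝ} (ht : 0 ≤ t) :
    exp (-(t • G₁)) v - exp (-(t • G₂)) v = -∫ s in (0:ℝ)..t, exp (-((t - s) • G₁)) ((G₁ - G₂) (exp (-(s • G₂)) v)) := by
  -- `x s := exp(−sG₂)v` solves `x' = −G₁ x + f`, `f s = (G₁ − G₂) x s`
  set x : ℝ → E := fun s => exp (-(s • G₂)) v with hx
  have hxd : ∀ s, HasDerivAt x (-(G₁ (x s)) + (G₁ - G₂) (x s)) s := by
    intro s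
    have h := hasDerivAt_exp_neg_smul_apply' G₂ v s
    have he : -(G₂ (exp (-(s • G₂)) v)) = -(G₁ (x s)) + (G₁ - G₂) (x s) := by
      simp only [hx, sub_apply]; abel
    rw [he] at h
    exact h
  have hxc : ContinuousOn x (Icc 0 t) := fun s _ => (hxd s).continuousAt.continuousWithinAt
  have hfc : ContinuousOn (fun s => (G₁ - G₂) (x s)) (Icc 0 t) := (G₁ - G₂).continuous.comp_continuousOn hxc
  have key := eq_exp_add_integral_of_hasDerivAt G₁ ht hxc hfc fun s _ => hxd s
  have hx0 : x 0 = v := by simp [hx]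
  have hxt : x t = exp (-(t • G₂)) v := rfl
  rw [hx0, sub_zero] at key
  rw [← hxt, key]
  abel

/-- **Two frozen flows under coercivity, linear-in-time bound**: with `r₁, r₂ ≥ 0` coercivity rates of `G₁, G₂`,
`‖exp(−tG₁)v − exp(−tG₂)v‖ ≤ ‖G₁ − G₂‖·t·‖v‖` (`t ≥ 0`). [cite: Hale1980, Ch. III §1, Theorem 1.1] [cite: SandersVerhulstMurdock2007, Lemma 5.2.7 (linear case)] -/
theorem norm_exp_sub_exp_apply_le_mul (G₁ G₂ : E →L[ℝ] E) {r₁ r₂ : ℝ} (hr₁ : 0 ≤ r₁) (hr₂ : 0 ≤ r₂)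
    (hG₁ : ∀ w, r₁ * ‖w‖ ^ 2 ≤ ⟪G₁ w, w⟫_ℝ) (hG₂ : ∀ w, r₂ * ‖w‖ ^ 2 ≤ ⟪G₂ w, w⟫_ℝ) (v : E) {t : ℝ} (ht : 0 ≤ t) :
    ‖exp (-(t • G₁)) v - exp (-(t • G₂)) v‖ ≤ ‖G₁ - G₂‖ * t * ‖v‖ := by
  rw [exp_sub_exp_apply_eq_integral G₁ G₂ v ht, norm_neg]
  have hb : ∀ s ∈ Set.Ioc 0 t, ‖exp (-((t - s) • G₁)) ((G₁ - G₂) (exp (-(s • G₂)) v))‖ ≤ ‖G₁ - G₂‖ * ‖v‖ := by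
    intro s hs
    have h1 := Literature.Analysis.ODE.PeriodicAveraging.norm_exp_neg_smul_apply_le G₁ hG₁ ((G₁ - G₂) (exp (-(s • G₂)) v))
      (τ := t - s) (by linarith [hs.2])
    have h2 := Literature.Analysis.ODE.PeriodicAveraging.norm_exp_neg_smul_apply_le G₂ hG₂ v (τ := s) hs.1.le
    have e1 : Real.exp (-(r₁ * (t - s))) ≤ 1 := Real.exp_le_one_iff.mpr (by nlinarith [hs.2])
    have e2 : Real.exp (-(r₂ * s)) ≤ 1 := Real.exp_le_one_iff.mpr (by nlinarith [hs.1])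
    have h3 : ‖(G₁ - G₂) (exp (-(s • G₂)) v)‖ ≤ ‖G₁ - G₂‖ * ‖v‖ :=
      ((G₁ - G₂).le_opNorm _).trans (mul_le_mul_of_nonneg_left (h2.trans (by nlinarith [norm_nonneg v])) (norm_nonneg _))
    calc ‖exp (-((t - s) • G₁)) ((G₁ - G₂) (exp (-(s • G₂)) v))‖
        ≤ Real.exp (-(r₁ * (t - s))) * ‖(G₁ - G₂) (exp (-(s • G₂)) v)‖ := h1
      _ ≤ 1 * (‖G₁ - G₂‖ * ‖v‖) := mul_le_mul e1 h3 (norm_nonneg _) zero_le_one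
      _ = ‖G₁ - G₂‖ * ‖v‖ := one_mul _
  have key := intervalIntegral.norm_integral_le_of_norm_le_const (a := 0) (b := t) (C := ‖G₁ - G₂‖ * ‖v‖)
    (f := fun s => exp (-((t - s) • G₁)) ((G₁ - G₂) (exp (-(s • G₂)) v))) (fun s hs => hb s (by rwa [uIoc_of_le ht] at hs))
  rw [sub_zero, abs_of_nonneg ht] at key
  calc _ ≤ ‖G₁ - G₂‖ * ‖v‖ * t := key
    _ = ‖G₁ - G₂‖ * t * ‖v‖ := by ring

/-- **Two frozen flows under coercivity, uniform-in-time bound**: if `G₁` is coercive with rate `r₁ > 0` and `G₂` with `r₂ ≥ 0`, then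
`‖exp(−tG₁)v − exp(−tG₂)v‖ ≤ (‖G₁ − G₂‖/r₁)·‖v‖` (`t ≥ 0`). [cite: SandersVerhulstMurdock2007, Theorem 5.5.1 (attraction), linear case] -/
theorem norm_exp_sub_exp_apply_le_div (G₁ G₂ : E →L[ℝ] E) {r₁ r₂ : ℝ} (hr₁ : 0 < r₁) (hr₂ : 0 ≤ r₂)
    (hG₁ : ∀ w, r₁ * ‖w‖ ^ 2 ≤ ⟪G₁ w, w⟫_ℝ) (hG₂ : ∀ w, r₂ * ‖w‖ ^ 2 ≤ ⟪G₂ w, w⟫_ℝ) (v : E) {t : ℝ} (ht : 0 ≤ t) :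
    ‖exp (-(t • G₁)) v - exp (-(t • G₂)) v‖ ≤ ‖G₁ - G₂‖ / r₁ * ‖v‖ := by
  rw [exp_sub_exp_apply_eq_integral G₁ G₂ v ht, norm_neg]
  have hb : ∀ s ∈ Set.Ioc 0 t, ‖exp (-((t - s) • G₁)) ((G₁ - G₂) (exp (-(s • G₂)) v))‖ ≤
      Real.exp (-(r₁ * (t - s))) * (‖G₁ - G₂‖ * ‖v‖) := by
    intro s hs
    have h1 := Literature.Analysis.ODE.PeriodicAveraging.norm_exp_neg_smul_apply_le G₁ hG₁ ((G₁ - G₂) (exp (-(s • G₂)) v))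
      (τ := t - s) (by linarith [hs.2])
    have h2 := Literature.Analysis.ODE.PeriodicAveraging.norm_exp_neg_smul_apply_le G₂ hG₂ v (τ := s) hs.1.le
    have e2 : Real.exp (-(r₂ * s)) ≤ 1 := Real.exp_le_one_iff.mpr (by nlinarith [hs.1])
    have h3 : ‖(G₁ - G₂) (exp (-(s • G₂)) v)‖ ≤ ‖G₁ - G₂‖ * ‖v‖ :=
      ((G₁ - G₂).le_opNorm _).trans (mul_le_mul_of_nonneg_left (h2.trans (by nlinarith [norm_nonneg v])) (norm_nonneg _))
    exact h1.trans (mul_le_mul_of_nonneg_left h3 (Real.exp_pos _).le)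
  have hint : IntervalIntegrable (fun s => Real.exp (-(r₁ * (t - s))) * (‖G₁ - G₂‖ * ‖v‖)) volume 0 t :=
    ((Real.continuous_exp.comp (continuous_const.mul (continuous_const.sub continuous_id)).neg).mul continuous_const).intervalIntegrable _ _
  have key := intervalIntegral.norm_integral_le_of_norm_le ht (Filter.Eventually.of_forall hb) hint
  -- `∫₀ᵗ e^{−r₁(t−s)} ds = (1 − e^{−r₁ t})/r₁ ≤ 1/r₁`
  have hprim : ∫ s in (0:ℝ)..t, Real.exp (-(r₁ * (t - s))) = (1 - Real.exp (-(r₁ * t))) / r₁ := by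
    have hd : ∀ s ∈ uIcc 0 t, HasDerivAt (fun s => Real.exp (-(r₁ * (t - s))) / r₁) (Real.exp (-(r₁ * (t - s)))) s := by
      intro s _
      have hr0 : r₁ ≠ 0 := hr₁.ne'
      have h := ((((hasDerivAt_id' s).const_sub t).const_mul r₁).neg.exp).div_const r₁
      simp only [Pi.neg_apply] at h
      refine h.congr_deriv ?_
      field_simp
    rw [integral_eq_sub_of_hasDerivAt hd ((Real.continuous_exp.comp (continuous_const.mul (continuous_const.sub continuous_id)).neg).intervalIntegrable _ _)]
    simp only [sub_self, mul_zero, neg_zero, Real.exp_zero]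
    field_simp
    ring
  have hle : ∫ s in (0:ℝ)..t, Real.exp (-(r₁ * (t - s))) * (‖G₁ - G₂‖ * ‖v‖) ≤ ‖G₁ - G₂‖ / r₁ * ‖v‖ := by
    rw [intervalIntegral.integral_mul_const, hprim]
    have h1 : (1 - Real.exp (-(r₁ * t))) / r₁ ≤ 1 / r₁ :=
      div_le_div_of_nonneg_right (by linarith [Real.exp_pos (-(r₁ * t))]) hr₁.le
    have h2 : 0 ≤ ‖G₁ - G₂‖ * ‖v‖ := by positivity
    calc (1 - Real.exp (-(r₁ * t))) / r₁ * (‖G₁ - G₂‖ * ‖v‖) ≤ 1 / r₁ * (‖G₁ - G₂‖ * ‖v‖) := mul_le_mul_of_nonneg_right h1 h2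
      _ = ‖G₁ - G₂‖ / r₁ * ‖v‖ := by ring
  exact key.trans hle

/-- **Two frozen flows under coercivity (packaged)**: `‖exp(−tG₁)v − exp(−tG₂)v‖ ≤ ‖G₁ − G₂‖·min t (1/r₁)·‖v‖` for `r₁ > 0`, `r₂ ≥ 0`, `t ≥ 0`.
[cite: SandersVerhulstMurdock2007, Theorem 5.5.1 (attraction), linear case] -/
theorem norm_exp_sub_exp_apply_le (G₁ G₂ : E →L[ℝ] E) {r₁ r₂ : ℝ} (hr₁ : 0 < r₁) (hr₂ : 0 ≤ r₂)
    (hG₁ : ∀ w, r₁ * ‖w‖ ^ 2 ≤ ⟪G₁ w, w⟫_ℝ) (hG₂ : ∀ w, r₂ * ‖w‖ ^ 2 ≤ ⟪G₂ w, w⟫_ℝ) (v : E) {t : ℝ} (ht : 0 ≤ t) :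
    ‖exp (-(t • G₁)) v - exp (-(t • G₂)) v‖ ≤ ‖G₁ - G₂‖ * min t (1 / r₁) * ‖v‖ := by
  rcases le_total t (1 / r₁) with h | h
  · rw [min_eq_left h]
    exact norm_exp_sub_exp_apply_le_mul G₁ G₂ hr₁.le hr₂ hG₁ hG₂ v ht
  · rw [min_eq_right h]
    have := norm_exp_sub_exp_apply_le_div G₁ G₂ hr₁ hr₂ hG₁ hG₂ v ht
    calc _ ≤ ‖G₁ - G₂‖ / r₁ * ‖v‖ := this
      _ = ‖G₁ - G₂‖ * (1 / r₁) * ‖v‖ := by ring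

/-- **Decay-relative form** (the shape the (V) clause consumes): if `‖G₁ − G₂‖ ≤ ε·Γ` with `0 < r₁ ≤ Γ` (`Γ` the rate scale, `r₁` the coercivity
of `G₁`, `G₂` coercive with any `r₂ ≥ 0`), then `‖exp(−tG₁)v − exp(−tG₂)v‖ ≤ ε·(Γ/r₁)·min 1 (Γ·t)·‖v‖` for `t ≥ 0`.
[cite: SandersVerhulstMurdock2007, Theorem 5.5.1 (attraction), linear case] -/
theorem norm_exp_sub_exp_apply_le_rel (G₁ G₂ : E →L[ℝ] E) {r₁ r₂ Γ ε : ℝ} (hr₁ : 0 < r₁) (hr₂ : 0 ≤ r₂) (hΓ : r₁ ≤ Γ) (hε : 0 ≤ ε)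
    (hG₁ : ∀ w, r₁ * ‖w‖ ^ 2 ≤ ⟪G₁ w, w⟫_ℝ) (hG₂ : ∀ w, r₂ * ‖w‖ ^ 2 ≤ ⟪G₂ w, w⟫_ℝ) (hdiff : ‖G₁ - G₂‖ ≤ ε * Γ)
    (v : E) {t : ℝ} (ht : 0 ≤ t) :
    ‖exp (-(t • G₁)) v - exp (-(t • G₂)) v‖ ≤ ε * (Γ / r₁) * min 1 (Γ * t) * ‖v‖ := by
  have h := norm_exp_sub_exp_apply_le G₁ G₂ hr₁ hr₂ hG₁ hG₂ v ht
  have hΓ0 : 0 < Γ := lt_of_lt_of_le hr₁ hΓ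
  -- `‖Δ‖·min t (1/r₁) ≤ εΓ·min t (1/r₁) = ε(Γ/r₁)·min (r₁ t) 1 ≤ ε(Γ/r₁)·min (Γt) 1`
  have hmin : Γ * min t (1 / r₁) ≤ (Γ / r₁) * min 1 (Γ * t) := by
    rcases le_total t (1 / r₁) with h1 | h1
    · rw [min_eq_left h1]
      have hrt : r₁ * t ≤ 1 := by rwa [le_div_iff₀ hr₁, mul_comm] at h1
      rcases le_total 1 (Γ * t) with h2 | h2
      · rw [min_eq_left h2]
        rw [div_mul_eq_mul_div, le_div_iff₀ hr₁, mul_one]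
        nlinarith
      · rw [min_eq_right h2]
        rw [div_mul_eq_mul_div, le_div_iff₀ hr₁]
        nlinarith [mul_le_mul_of_nonneg_left hΓ (mul_nonneg hΓ0.le ht)]
    · rw [min_eq_right h1]
      have hrt : 1 ≤ r₁ * t := by rwa [div_le_iff₀ hr₁, mul_comm] at h1
      have hge : 1 ≤ Γ * t := hrt.trans (mul_le_mul_of_nonneg_right hΓ ht)
      rcases le_total 1 (Γ * t) with h2 | h2
      · rw [min_eq_left h2]; rw [mul_one_div, mul_one]
      · rw [min_eq_right h2, le_antisymm h2 hge, mul_one, mul_one_div]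
  have hv : 0 ≤ ‖v‖ := norm_nonneg v
  have hm0 : 0 ≤ min t (1 / r₁) := le_min ht (by positivity)
  calc ‖exp (-(t • G₁)) v - exp (-(t • G₂)) v‖ ≤ ‖G₁ - G₂‖ * min t (1 / r₁) * ‖v‖ := h
    _ ≤ ε * Γ * min t (1 / r₁) * ‖v‖ := by gcongr
    _ = ε * (Γ * min t (1 / r₁)) * ‖v‖ := by ring
    _ ≤ ε * ((Γ / r₁) * min 1 (Γ * t)) * ‖v‖ := by gcongr
    _ = ε * (Γ / r₁) * min 1 (Γ * t) * ‖v‖ := by ring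

end TwoSemigroup

end Summit.AnomalousDissipation.AnomalousDissipation.Theorems.SolenoidalFractalHomogenisation.LagrangianStep.CellChain

end
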